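import Literature.Probability.LatticeModels.DiscreteGreenKernelConvergence
import Literature.Probability.LatticeModels.MeshDomainJordan
import Literature.Probability.RandomPlanarGeometry.JordanBoundaryLemmas
import Literature.Probability.RandomPlanarGeometry.JordanDomainInterior
import Literature.Probability.RandomPlanarGeometry.ChordalLERWScalingLimit
import HarnessLib

/-!
# Kernel convergence of the inner lattice approximants of a Jordan domain
— helper of stub `stub_greenConvergence` (GC) of line `symplectic-fermion-anchor`
(crux `SAWLoopFugacityFlow.AvoidanceLimit`, stmt-CriticalPhenomena-10649; lead c2 GC-sandwich
programme, brick W-D)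

**What.** Fix Jordan domains `D' ⊆ D` and a base point `zs ∈ D'`. At mesh `δ` the *inner
approximant* of `D'` is the set `Inner_δ` of sites `y ∈ meshDomain D.carrier δ` whose closed
`2δ`-ball about the mesh point `δy` lies in `D'`; `C_δ` is the set of sites reachable from the base
site `nearestSite δ zs` in `ChordalLERW.siteGraph Inner_δ`. The two registered signatures of W-D:
* `eventually_mem_innerComponent`: for a compact `K ⊆ D'`, for all small `δ > 0` every site whose
  mesh point lies in `K` belongs to `C_δ`;
* `kernelConvergence_inner`: the polygonal domains `δ • starDomain C_δ` converge to `D'` in the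
  kernel (Carathéodory) sense `ChelkakSmirnov.KernelConvergence`.

**Proof.** *Margin* (`exists_margin`): the points of `K` are joined to `zs` by paths of `D'` at
distance `> η` from `∂D'` (`JordanDomain.exists_joined_far_of_isCompact`); the compact
`closure D' ∩ {infDist · ∂D' ≥ η/2}` lies in `D' ⊆ D`, so for small `δ` all its lattice points are
in `meshDomain D.carrier δ` (bulk lemma `JordanDomain.exists_forall_mem_meshDomain_and_reachable`).
*Good sites* (`mem_inner_of_dist_lt`): for `8δ ≤ η`, a site within `3δ` of a point `p ∈ D'` with
`infDist p ∂D' > η` is in `Inner_δ`. *Local step*: the nearest sites of two points `δ/4`-close to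
such a `p` are joined by a two-leg lattice path of good sites. *Along a path*: the relation "the
nearest sites of `γ s`, `γ t` are joined" is then open on `[0, 1]`, hence total
(`PreconnectedSpace.induction₂'`); as `nearestSite δ (δu) = u` this is
`eventually_mem_innerComponent`. Kernel convergence (i): apply it to `closedBall z (ε/2) ⊆ D'`; a
point `w ∈ ball z (ε/4)` lies in the open star of `nearestSite δ w`, whose mesh point is in that
ball once `δ < ε/4`. (ii): for small `δ` the base site is good, so `C_δ ⊆ Inner_δ` and
`U = δ • starDomain C_δ ⊆ D'` misses `a ∈ ∂D'`; a point `z ∈ D'` with `dist z a < ρ/2` is interior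
to `U` by (i), and the connected segment `[z, a] ⊆ ball a ρ` meets `∂U`
(`IsPreconnected.subset_of_closure_inter_subset`). Folklore; nothing from the literature asserted.
-/

noncomputable section

open scoped BigOperators Topology Pointwise
open Filter Finset
open Literature.Probability.RandomPlanarGeometry Literature.Probability.LatticeModels

namespace Summit.CriticalPhenomena.SAWScalingLimit.Theorems.AvoidanceLimit.Anchor

namespace InnerKernel

/-- Walking along the coordinate axis `i` from `w` to `w + k eᵢ` in `ChordalLERW.siteGraph A`,
given that every site of the closed lattice segment lies in `A` (adapted from
`reflTransGen_faceStep_add_single` of brick W-C1 of this programme). [folklore] -/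
theorem siteGraph_reachable_add_single (A : Set (Site 2)) (w : Site 2) (i : Fin 2) (k : ℤ) :
    (∀ j : ℤ, (0 ≤ j ∧ j ≤ k) ∨ (k ≤ j ∧ j ≤ 0) → w + Pi.single i j ∈ A) →
      (ChordalLERW.siteGraph A).Reachable w (w + Pi.single i k) := by
  induction k using Int.induction_on with
  | zero => intro _; rw [Pi.single_zero, add_zero]
  | succ n ih =>
    intro h
    refine (ih fun j hj => h j (by omega)).trans (SimpleGraph.Adj.reachable ?_)
    refine ChordalLERW.siteGraph_adj_iff.2 ⟨?_, h n (by omega), h (n + 1) (by omega)⟩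
    rw [zdGraph_adj_iff]
    exact ⟨i, Or.inl (by rw [add_assoc, ← Pi.single_add])⟩
  | pred n ih =>
    intro h
    refine (ih fun j hj => h j (by omega)).trans (SimpleGraph.Adj.reachable ?_)
    refine ChordalLERW.siteGraph_adj_iff.2 ⟨?_, h (-n) (by omega), h (-n - 1) (by omega)⟩
    rw [zdGraph_adj_iff]
    refine ⟨i, Or.inr ?_⟩
    rw [add_assoc, ← Pi.single_add, sub_add_cancel]

/-- **Two-leg lattice path.** If every lattice point lying coordinatewise between `a` and `b`
belongs to `A`, then `a` and `b` are joined in `ChordalLERW.siteGraph A` (first along the first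
axis to the corner `(b₀, a₁)`, then along the second). [folklore] -/
theorem siteGraph_reachable_of_forall_mem {A : Set (Site 2)} (a b : Site 2)
    (hA : ∀ x : Site 2, (∀ j, x j ∈ Set.uIcc (a j) (b j)) → x ∈ A) :
    (ChordalLERW.siteGraph A).Reachable a b := by
  have hc : a + Pi.single (0 : Fin 2) (b 0 - a 0) + Pi.single (1 : Fin 2) (b 1 - a 1) = b := by
    ext j; fin_cases j <;> simp
  have h1 : (ChordalLERW.siteGraph A).Reachable a (a + Pi.single (0 : Fin 2) (b 0 - a 0)) := by
    refine siteGraph_reachable_add_single A a 0 _ fun j hj => hA _ fun l => ?_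
    fin_cases l <;> simp [Set.mem_uIcc]
    omega
  have h2 := siteGraph_reachable_add_single A (a + Pi.single (0 : Fin 2) (b 0 - a 0)) 1
    (b 1 - a 1) fun j hj => hA _ fun l => by
      fin_cases l <;> simp [Set.mem_uIcc]
      omega
  rw [hc] at h2
  exact h1.trans h2

/-- The sites reachable from a site of `A` in `ChordalLERW.siteGraph A` lie in `A`. [folklore] -/
theorem mem_of_siteGraph_reachable {A : Set (Site 2)} {b x : Site 2} (hb : b ∈ A)
    (h : (ChordalLERW.siteGraph A).Reachable b x) : x ∈ A := by
  rw [SimpleGraph.reachable_iff_reflTransGen] at h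
  induction h with
  | refl => exact hb
  | tail _ hadj _ => exact (ChordalLERW.siteGraph_adj_iff.1 hadj).2.2

/-- Coordinatewise, the mesh point of `nearestSite δ w` is within `δ / 2` of `w`. [folklore] -/
theorem abs_sub_nearestSite_le {δ : ℝ} (hδ : 0 < δ) (w : ℂ) :
    |w.re - δ * ((nearestSite δ w 0 : ℤ) : ℝ)| ≤ δ / 2 ∧
      |w.im - δ * ((nearestSite δ w 1 : ℤ) : ℝ)| ≤ δ / 2 := by
  have key : ∀ a : ℝ, |a - δ * (round (a / δ) : ℤ)| ≤ δ / 2 := fun a => by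
    have h := abs_sub_round (a / δ)
    rw [show a - δ * (round (a / δ) : ℤ) = δ * (a / δ - round (a / δ)) by
      rw [mul_sub, mul_div_cancel₀ _ hδ.ne'], abs_mul, abs_of_pos hδ]
    nlinarith
  simp only [nearestSite, Matrix.cons_val_zero, Matrix.cons_val_one]
  exact ⟨key w.re, key w.im⟩

/-- Points of the mesh-`δ` polygonal domain `δ • starDomain A`: those within `δ` of the mesh point
of a site of `A` in each coordinate (the open square of side `2δ` about `δx`). [folklore] -/
theorem mem_smul_starDomain_iff {δ : ℝ} (hδ : 0 < δ) {A : Set (Site 2)} {w : ℂ} :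
    w ∈ δ • ChelkakSmirnov.starDomain A ↔
      ∃ x ∈ A, |w.re - δ * ((x 0 : ℤ) : ℝ)| < δ ∧ |w.im - δ * ((x 1 : ℤ) : ℝ)| < δ := by
  have hδ0 : δ ≠ 0 := hδ.ne'
  rw [Set.mem_smul_set_iff_inv_smul_mem₀ hδ0, ChelkakSmirnov.starDomain, Set.mem_iUnion₂]
  simp only [Set.mem_setOf_eq, Complex.smul_re, Complex.smul_im, smul_eq_mul, exists_prop]
  have key : ∀ (a : ℝ) (k : ℤ), |δ⁻¹ * a - k| < 1 ↔ |a - δ * k| < δ := fun a k => by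
    rw [show δ⁻¹ * a - k = (a - δ * k) / δ by field_simp, abs_div, abs_of_pos hδ, div_lt_one hδ]
  simp only [key]

/-- The mesh-`δ` polygonal domain of a set of sites all of whose closed `2δ`-balls lie in `S` lies
in `S` (the open star of a site is within distance `2δ` of its mesh point). [folklore] -/
theorem smul_starDomain_subset {δ : ℝ} (hδ : 0 < δ) {C : Set (Site 2)} {S : Set ℂ}
    (hC : ∀ x ∈ C, Metric.closedBall (meshPoint δ x) (2 * δ) ⊆ S) :
    δ • ChelkakSmirnov.starDomain C ⊆ S := by
  intro w hw
  obtain ⟨x, hx, hre, him⟩ := (mem_smul_starDomain_iff hδ).1 hw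
  refine hC x hx (Metric.mem_closedBall.2 ?_)
  rw [Complex.dist_eq]
  calc ‖w - meshPoint δ x‖ ≤ |(w - meshPoint δ x).re| + |(w - meshPoint δ x).im| :=
        Complex.norm_le_abs_re_add_abs_im _
    _ = |w.re - δ * ((x 0 : ℤ) : ℝ)| + |w.im - δ * ((x 1 : ℤ) : ℝ)| := by
        simp only [Complex.sub_re, Complex.sub_im, meshPoint_re, meshPoint_im]
    _ ≤ 2 * δ := by linarith

/-- A ball about a point of a Jordan domain, of radius at most the distance to the boundary curve,
lies in the domain (a segment leaving the domain crosses its frontier). [folklore] -/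
theorem ball_subset_carrier_of_le_infDist (D' : JordanDomain) {p : ℂ} (hp : p ∈ D'.carrier)
    {r : ℝ} (hr : r ≤ Metric.infDist p (frontier D'.carrier)) : Metric.ball p r ⊆ D'.carrier := by
  intro y hy
  by_contra hyD
  obtain ⟨f, hfseg, hf⟩ := D'.inter_frontier_nonempty_of_isPreconnected
    (convex_segment p y).isPreconnected ⟨p, left_mem_segment ℝ p y, hp⟩
    ⟨y, right_mem_segment ℝ p y, hyD⟩
  have hfball : f ∈ Metric.ball p r :=
    (convex_ball p r).segment_subset (Metric.mem_ball_self (Metric.pos_of_mem_ball hy)) hy hfseg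
  have h1 : Metric.infDist p (frontier D'.carrier) ≤ dist p f := Metric.infDist_le_dist_of_mem hf
  have h2 : dist f p < r := Metric.mem_ball.1 hfball
  rw [dist_comm] at h2
  linarith

/-- **Good sites.** Let `p ∈ D'` be at distance `> η` from the boundary curve, `8δ ≤ η`, and
suppose every lattice point whose mesh point lies in `closure D'` at distance `≥ η/2` from the
boundary is in `meshDomain D.carrier δ`. Then every site whose mesh point is within `3δ` of `p` is
a site of the inner approximant. [folklore] -/
theorem mem_inner_of_dist_lt {D D' : JordanDomain} {δ η : ℝ} (hδ : 0 < δ) (hδη : 8 * δ ≤ η)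
    (hbulk : ∀ x : Site 2, meshPoint δ x ∈ closure D'.carrier →
      η / 2 ≤ Metric.infDist (meshPoint δ x) (frontier D'.carrier) → x ∈ meshDomain D.carrier δ)
    {p : ℂ} (hp : p ∈ D'.carrier) (hpη : η < Metric.infDist p (frontier D'.carrier))
    {w : Site 2} (hw : dist (meshPoint δ w) p < 3 * δ) :
    w ∈ meshDomain D.carrier δ ∧ Metric.closedBall (meshPoint δ w) (2 * δ) ⊆ D'.carrier := by
  have hball : Metric.ball p η ⊆ D'.carrier := ball_subset_carrier_of_le_infDist D' hp hpη.le
  refine ⟨hbulk w ?_ ?_, fun y hy => hball ?_⟩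
  · exact subset_closure (hball (Metric.mem_ball.2 (by linarith)))
  · have := Metric.infDist_le_infDist_add_dist (x := p) (y := meshPoint δ w)
      (s := frontier D'.carrier)
    rw [dist_comm] at hw
    linarith
  · calc dist y p ≤ dist y (meshPoint δ w) + dist (meshPoint δ w) p := dist_triangle _ _ _
      _ < 2 * δ + 3 * δ := add_lt_add_of_le_of_lt (Metric.mem_closedBall.1 hy) hw
      _ ≤ η := by linarith

/-- **Local step.** Under the hypotheses of `mem_inner_of_dist_lt`, the nearest sites of two points
`w`, `z` with `dist w z < δ/4` and `z` deep inside `D'` are joined in the site graph of the inner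
approximant (a two-leg path in the rectangle they span, all of whose lattice points are good).
[folklore] -/
theorem reachable_nearestSite_of_dist_lt {D D' : JordanDomain} {δ η : ℝ} (hδ : 0 < δ)
    (hδη : 8 * δ ≤ η)
    (hbulk : ∀ x : Site 2, meshPoint δ x ∈ closure D'.carrier →
      η / 2 ≤ Metric.infDist (meshPoint δ x) (frontier D'.carrier) → x ∈ meshDomain D.carrier δ)
    {z : ℂ} (hz : z ∈ D'.carrier) (hzη : η < Metric.infDist z (frontier D'.carrier))
    {w : ℂ} (hw : dist w z < δ / 4) :
    (ChordalLERW.siteGraph {y : Site 2 | y ∈ meshDomain D.carrier δ ∧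
        Metric.closedBall (meshPoint δ y) (2 * δ) ⊆ D'.carrier}).Reachable
      (nearestSite δ w) (nearestSite δ z) := by
  have h1 : dist (meshPoint δ (nearestSite δ z)) z < 5 / 4 * δ :=
    (dist_meshPoint_nearestSite_le hδ z).trans_lt (by linarith)
  have h2 : dist (meshPoint δ (nearestSite δ w)) z < 5 / 4 * δ :=
    calc dist (meshPoint δ (nearestSite δ w)) z
        ≤ dist (meshPoint δ (nearestSite δ w)) w + dist w z := dist_triangle _ _ _
      _ < δ + δ / 4 := add_lt_add_of_le_of_lt (dist_meshPoint_nearestSite_le hδ w) hw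
      _ = 5 / 4 * δ := by ring
  have hR : Complex.Rectangle (meshPoint δ (nearestSite δ w)) (meshPoint δ (nearestSite δ z)) ⊆
      Metric.ball z (2 * (5 / 4 * δ)) := rectangle_subset_ball h2 h1
  refine siteGraph_reachable_of_forall_mem _ _ fun x hx => ?_
  have hx' : dist (meshPoint δ x) z < 3 * δ := by
    have := Metric.mem_ball.1 (hR (meshPoint_mem_rectangle hδ.le hx))
    linarith
  exact mem_inner_of_dist_lt hδ hδη hbulk hz hzη hx'

/-- **Along a path.** Under the hypotheses of `mem_inner_of_dist_lt`, if `γ` is a path from `x` to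
`zs` deep inside `D'`, then `nearestSite δ x` is joined to `nearestSite δ zs` in the site graph of
the inner approximant: the relation "the nearest sites of `γ s` and `γ t` are joined" is open on
`[0, 1]` by the local step, hence total (`PreconnectedSpace.induction₂'`). [folklore] -/
theorem reachable_nearestSite_of_path {D D' : JordanDomain} {δ η : ℝ} (hδ : 0 < δ)
    (hδη : 8 * δ ≤ η)
    (hbulk : ∀ x : Site 2, meshPoint δ x ∈ closure D'.carrier →
      η / 2 ≤ Metric.infDist (meshPoint δ x) (frontier D'.carrier) → x ∈ meshDomain D.carrier δ)
    {x zs : ℂ} (γ : Path x zs)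
    (hγ : ∀ t, γ t ∈ D'.carrier ∧ η < Metric.infDist (γ t) (frontier D'.carrier)) :
    (ChordalLERW.siteGraph {y : Site 2 | y ∈ meshDomain D.carrier δ ∧
        Metric.closedBall (meshPoint δ y) (2 * δ) ⊆ D'.carrier}).Reachable
      (nearestSite δ zs) (nearestSite δ x) := by
  set G := ChordalLERW.siteGraph {y : Site 2 | y ∈ meshDomain D.carrier δ ∧
        Metric.closedBall (meshPoint δ y) (2 * δ) ⊆ D'.carrier} with hG
  have key : ∀ s t : unitInterval, G.Reachable (nearestSite δ (γ s)) (nearestSite δ (γ t)) := by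
    intro s₀ t₀
    refine PreconnectedSpace.induction₂'
      (fun s t : unitInterval => G.Reachable (nearestSite δ (γ s)) (nearestSite δ (γ t)))
      (fun s => ?_) ⟨fun a b c hab hbc => hab.trans hbc⟩ s₀ t₀
    have hcont : ContinuousAt γ s := γ.continuous.continuousAt
    filter_upwards [hcont (Metric.ball_mem_nhds (γ s) (by positivity : (0 : ℝ) < δ / 4))]
      with t ht
    have h := reachable_nearestSite_of_dist_lt hδ hδη hbulk (hγ s).1 (hγ s).2 (Metric.mem_ball.1 ht)
    exact ⟨h.symm, h⟩
  simpa only [γ.source, γ.target] using key 1 0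

/-- **Margin and scales.** For a compact `K ⊆ D'` and `zs ∈ D'`: a margin `η > 0` such that every
point of `K` is joined to `zs` by a path of `D'` at distance `> η` from the boundary curve, and, for
all small mesh `δ > 0`, `8δ ≤ η` and every lattice point of `closure D'` at distance `≥ η/2` from
the boundary lies in `meshDomain D.carrier δ` (bulk lemma for a compact subset of `D' ⊆ D`).
[folklore] -/
theorem exists_margin (D D' : JordanDomain) {zs : ℂ} {K : Set ℂ} (hD : D'.carrier ⊆ D.carrier)
    (hzs : zs ∈ D'.carrier) (hK : IsCompact K) (hKD : K ⊆ D'.carrier) :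
    ∃ η : ℝ, 0 < η ∧
      (∀ x ∈ K, ∃ γ : Path x zs, ∀ t,
        γ t ∈ D'.carrier ∧ η < Metric.infDist (γ t) (frontier D'.carrier)) ∧
      ∀ᶠ δ in 𝓝[>] (0 : ℝ), 0 < δ ∧ 8 * δ ≤ η ∧
        ∀ x : Site 2, meshPoint δ x ∈ closure D'.carrier →
          η / 2 ≤ Metric.infDist (meshPoint δ x) (frontier D'.carrier) →
            x ∈ meshDomain D.carrier δ := by
  obtain ⟨η, hη, hpath⟩ := D'.exists_joined_far_of_isCompact hzs hK hKD
  set Kη : Set ℂ := closure D'.carrier ∩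
    {p | η / 2 ≤ Metric.infDist p (frontier D'.carrier)} with hKη
  have hKηc : IsCompact Kη :=
    D'.isBounded.isCompact_closure.inter_right
      (isClosed_le continuous_const (Metric.continuous_infDist_pt _))
  have hKηD : Kη ⊆ D.carrier := by
    rintro p ⟨hp1, hp2⟩
    refine hD ?_
    rw [closure_eq_self_union_frontier] at hp1
    rcases hp1 with h | h
    · exact h
    · exact absurd hp2 (by rw [Set.mem_setOf_eq, Metric.infDist_zero_of_mem h, not_le]; positivity)
  obtain ⟨δ₁, hδ₁, hbulk⟩ := D.exists_forall_mem_meshDomain_and_reachable hKηc hKηD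
  refine ⟨η, hη, hpath, ?_⟩
  filter_upwards [Ioo_mem_nhdsGT (lt_min hδ₁ (by positivity : (0 : ℝ) < η / 8))] with δ hδ
  obtain ⟨hδ0, hδlt⟩ := hδ
  exact ⟨hδ0, by linarith [hδlt.trans_le (min_le_right _ _)],
    fun x hx1 hx2 => (hbulk δ hδ0 (hδlt.trans_le (min_le_left _ _))).1 x ⟨hx1, hx2⟩⟩

end InnerKernel

/-- **Compacta are swallowed by the inner component** (brick W-D, registered signature). For Jordan
domains `D' ⊆ D`, a base point `zs ∈ D'` and a compact `K ⊆ D'`: for all small mesh `δ > 0`, every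
site whose mesh point lies in `K` is joined to the base site `nearestSite δ zs` in the site graph
of the inner approximant `{y ∈ meshDomain D.carrier δ | closedBall (δy) (2δ) ⊆ D'}`. [folklore] -/
theorem eventually_mem_innerComponent :
    ∀ (D D' : JordanDomain) (zs : ℂ) (K : Set ℂ), D'.carrier ⊆ D.carrier → zs ∈ D'.carrier →
      IsCompact K → K ⊆ D'.carrier →
      ∀ᶠ δ in 𝓝[>] (0 : ℝ), ∀ u : Site 2, meshPoint δ u ∈ K →
        (ChordalLERW.siteGraph {y : Site 2 | y ∈ meshDomain D.carrier δ ∧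
          Metric.closedBall (meshPoint δ y) (2 * δ) ⊆ D'.carrier}).Reachable
          (nearestSite δ zs) u := by
  intro D D' zs K hD hzs hK hKD
  obtain ⟨η, -, hpath, hev⟩ := InnerKernel.exists_margin D D' hD hzs hK hKD
  filter_upwards [hev] with δ hδ u hu
  obtain ⟨hδ0, hδη, hbulk⟩ := hδ
  obtain ⟨γ, hγ⟩ := hpath _ hu
  have h := InnerKernel.reachable_nearestSite_of_path hδ0 hδη hbulk γ hγ
  rwa [nearestSite_meshPoint hδ0.ne'] at h

namespace InnerKernel

/-- Part (i) of kernel convergence of the inner approximants: every `z ∈ D'` has a ball which, for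
all small `δ`, lies in the polygonal domain of the inner component (each point of the ball lies in
the open star of its nearest site, whose mesh point is in a fixed compact ball of `D'`).
[folklore] -/
theorem exists_ball_subset_smul_starDomain_inner (D D' : JordanDomain) {zs : ℂ}
    (hD : D'.carrier ⊆ D.carrier) (hzs : zs ∈ D'.carrier) {z : ℂ} (hz : z ∈ D'.carrier) :
    ∃ ρ : ℝ, 0 < ρ ∧ ∀ᶠ δ in 𝓝[>] (0 : ℝ), Metric.ball z ρ ⊆
      δ • ChelkakSmirnov.starDomain {x : Site 2 |
        (ChordalLERW.siteGraph {y : Site 2 | y ∈ meshDomain D.carrier δ ∧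
          Metric.closedBall (meshPoint δ y) (2 * δ) ⊆ D'.carrier}).Reachable
          (nearestSite δ zs) x} := by
  obtain ⟨ε, hε, hεD⟩ := Metric.isOpen_iff.1 D'.isOpen z hz
  refine ⟨ε / 4, by positivity, ?_⟩
  have hK : IsCompact (Metric.closedBall z (ε / 2)) := isCompact_closedBall z (ε / 2)
  have hKD : Metric.closedBall z (ε / 2) ⊆ D'.carrier :=
    (Metric.closedBall_subset_ball (by linarith)).trans hεD
  filter_upwards [eventually_mem_innerComponent D D' zs _ hD hzs hK hKD,
    Ioo_mem_nhdsGT (by positivity : (0 : ℝ) < ε / 4)] with δ hδK hδI w hw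
  obtain ⟨hδ0, hδε⟩ := hδI
  have hu : meshPoint δ (nearestSite δ w) ∈ Metric.closedBall z (ε / 2) := by
    rw [Metric.mem_closedBall]
    calc dist (meshPoint δ (nearestSite δ w)) z
        ≤ dist (meshPoint δ (nearestSite δ w)) w + dist w z := dist_triangle _ _ _
      _ ≤ δ + ε / 4 := add_le_add (dist_meshPoint_nearestSite_le hδ0 w) (Metric.mem_ball.1 hw).le
      _ ≤ ε / 2 := by linarith
  obtain ⟨hre, him⟩ := abs_sub_nearestSite_le hδ0 w
  exact (mem_smul_starDomain_iff hδ0).2 ⟨nearestSite δ w, hδK _ hu, by linarith, by linarith⟩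

/-- For all small `δ` the base site `nearestSite δ zs` is a site of the inner approximant.
[folklore] -/
theorem eventually_nearestSite_mem_inner (D D' : JordanDomain) {zs : ℂ}
    (hD : D'.carrier ⊆ D.carrier) (hzs : zs ∈ D'.carrier) :
    ∀ᶠ δ in 𝓝[>] (0 : ℝ), nearestSite δ zs ∈ meshDomain D.carrier δ ∧
      Metric.closedBall (meshPoint δ (nearestSite δ zs)) (2 * δ) ⊆ D'.carrier := by
  obtain ⟨η, -, hpath, hev⟩ :=
    exists_margin D D' hD hzs isCompact_singleton (Set.singleton_subset_iff.2 hzs)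
  obtain ⟨γ, hγ⟩ := hpath zs (Set.mem_singleton zs)
  have hzsη : η < Metric.infDist zs (frontier D'.carrier) := by
    have := (hγ 0).2
    rwa [γ.source] at this
  filter_upwards [hev] with δ hδ
  obtain ⟨hδ0, hδη, hbulk⟩ := hδ
  exact mem_inner_of_dist_lt hδ0 hδη hbulk hzs hzsη
    ((dist_meshPoint_nearestSite_le hδ0 zs).trans_lt (by linarith))

/-- Part (ii) of kernel convergence of the inner approximants: every boundary point `a` of `D'` is,
for every `ρ > 0` and all small `δ`, within `ρ` of the frontier of the polygonal domain `U` of the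
inner component (`U ⊆ D'` misses `a` and has an interior point `z` with `dist z a < ρ/2` by
part (i); the segment `[z, a] ⊆ ball a ρ` crosses the frontier of `U`). [folklore] -/
theorem frontier_smul_starDomain_inner_near (D D' : JordanDomain) {zs : ℂ}
    (hD : D'.carrier ⊆ D.carrier) (hzs : zs ∈ D'.carrier) {a : ℂ} (ha : a ∈ frontier D'.carrier)
    {ρ : ℝ} (hρ : 0 < ρ) :
    ∀ᶠ δ in 𝓝[>] (0 : ℝ), (frontier (δ • ChelkakSmirnov.starDomain {x : Site 2 |
        (ChordalLERW.siteGraph {y : Site 2 | y ∈ meshDomain D.carrier δ ∧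
          Metric.closedBall (meshPoint δ y) (2 * δ) ⊆ D'.carrier}).Reachable
          (nearestSite δ zs) x}) ∩ Metric.ball a ρ).Nonempty := by
  -- an interior point `z` near `a`
  obtain ⟨z, hz, hza⟩ :=
    Metric.mem_closure_iff.1 (frontier_subset_closure ha) (ρ / 2) (by positivity)
  obtain ⟨ρz, hρz, hevz⟩ := exists_ball_subset_smul_starDomain_inner D D' hD hzs hz
  filter_upwards [hevz, eventually_nearestSite_mem_inner D D' hD hzs, self_mem_nhdsWithin]
    with δ hzU hb hδ0
  rw [Set.mem_Ioi] at hδ0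
  set U : Set ℂ := δ • ChelkakSmirnov.starDomain {x : Site 2 |
        (ChordalLERW.siteGraph {y : Site 2 | y ∈ meshDomain D.carrier δ ∧
          Metric.closedBall (meshPoint δ y) (2 * δ) ⊆ D'.carrier}).Reachable (nearestSite δ zs) x}
    with hU
  have hUD : U ⊆ D'.carrier :=
    smul_starDomain_subset hδ0 fun x hx => (mem_of_siteGraph_reachable hb hx).2
  have haU : a ∉ U := fun h => by
    have : a ∈ D'.carrier ∩ frontier D'.carrier := ⟨hUD h, ha⟩
    rw [D'.isOpen.inter_frontier_eq] at this
    exact this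
  have hzball : z ∈ Metric.ball a ρ := by
    rw [Metric.mem_ball, dist_comm]
    linarith
  have hseg : segment ℝ z a ⊆ Metric.ball a ρ :=
    (convex_ball a ρ).segment_subset hzball (Metric.mem_ball_self hρ)
  by_contra hcon -- else the connected segment `[z, a]` would stay inside `interior U`
  have hzint : z ∈ interior U :=
    mem_interior.2 ⟨Metric.ball z ρz, hzU, Metric.isOpen_ball, Metric.mem_ball_self hρz⟩
  have hsub : segment ℝ z a ⊆ interior U := by
    refine (convex_segment z a).isPreconnected.subset_of_closure_inter_subset isOpen_interior
      ⟨z, left_mem_segment ℝ z a, hzint⟩ ?_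
    rintro q ⟨hq1, hq2⟩
    by_contra hq3
    exact hcon ⟨q, ⟨closure_mono interior_subset hq1, hq3⟩, hseg hq2⟩
  exact haU (interior_subset (hsub (right_mem_segment ℝ z a)))

end InnerKernel

/-- **Kernel convergence of the inner approximants** (brick W-D, registered signature). For Jordan
domains `D' ⊆ D` and a base point `zs ∈ D'`, the polygonal domains `δ • starDomain C_δ` of the
component `C_δ` of `nearestSite δ zs` in the site graph of the inner approximant
`{y ∈ meshDomain D.carrier δ | closedBall (δy) (2δ) ⊆ D'}` converge to `D'` in the kernel
(Carathéodory) sense as `δ → 0⁺`. [folklore] -/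
theorem kernelConvergence_inner :
    ∀ (D D' : JordanDomain) (zs : ℂ), D'.carrier ⊆ D.carrier → zs ∈ D'.carrier →
      ChelkakSmirnov.KernelConvergence
        (fun δ : ℝ => δ • ChelkakSmirnov.starDomain {x : Site 2 |
          (ChordalLERW.siteGraph {y : Site 2 | y ∈ meshDomain D.carrier δ ∧
            Metric.closedBall (meshPoint δ y) (2 * δ) ⊆ D'.carrier}).Reachable
            (nearestSite δ zs) x}) D'.carrier := by
  intro D D' zs hD hzs
  exact ⟨fun z hz => InnerKernel.exists_ball_subset_smul_starDomain_inner D D' hD hzs hz,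
    fun a ha ρ hρ => InnerKernel.frontier_smul_starDomain_inner_near D D' hD hzs ha hρ⟩

end Summit.CriticalPhenomena.SAWScalingLimit.Theorems.AvoidanceLimit.Anchor

end
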